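import Summits.KontsevichZagierPeriods.KontsevichZagierPeriods.Theses.TerasomaMultiplication
import Literature.NumberTheory.Transcendental.KZHomotopyMoves
import Literature.NumberTheory.Transcendental.SemialgebraicRpow
import Literature.NumberTheory.Transcendental.SemialgebraicLineDeriv
import Literature.NumberTheory.Transcendental.KZLogCalculusProofs

/-!
# `MultiplicationAccessible` (stmt-KontsevichZagierPeriods-12305), line `shifted-family-prime-sieve`:
the `v`-direction Newton–Leibniz move of the corner Stokes at `p = 3`

The Liouville rotation flow (idea card `liouville-rotation-flow`, design `CornerP3Design.md` v2.3)
proves the shifted Gauss triplication by Stokes on `W = U × (0,1)_v`, `U` the corner blow-up chart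
domain of the cube (`t_k = 1 − yθ_k`, `u = (θ₁, θ₂, y)`); the component
`c₃ = −v^(3x)·((1−vζ)/(1−ζ))^(3s−1)·GD(u)` (`ζ = (t₀t₁t₂)^(1/3)`, `GD` the graph density of the landed
`blowupChartThree`) is elementary in `v`, and ONE rule-3 move in `v` (band `[0,1]` over `U`, primitive
`−c₃`) gives `[W, ∂_v(−c₃)] ∼ [U, GD]` (`cornerStokesV`, registered sub-goal). `GD` enters only through
a representation pinned on `U` and the bound `|GD| ≤ C (1−ζ)^(3s−1)` (a separate sub-goal).
References: Kontsevich–Zagier 2001 §1.2 rule (3); Andrews–Askey–Roy 1999 pp. 30–31.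
-/

noncomputable section

open MeasureTheory Set Real
open scoped BigOperators
open Literature.NumberTheory.Transcendental
open Literature.NumberTheory.Transcendental.KZ
open Literature.ModelTheory.ExponentialFields (IsSemialgebraic isSemialgebraic_setOf_eval_pos
  isSemialgebraic_setOf_eval_lt)
open MvPolynomial (aeval X C)

namespace Summit.KontsevichZagierPeriods.TerasomaMultiplication.MultiplicationAccessible

namespace CornerV

/-- On the chart domain `U` every box coordinate `t_k = 1 − yθ_k` lies in `(0,1)`, `y > 0`, and the
product `t₀t₁t₂` lies in `(0,1)`. [folklore] -/
theorem tprod_mem {u : Fin 3 → ℝ}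
    (hu : 0 < u 0 ∧ 0 < u 1 ∧ u 0 + u 1 < 1 ∧ 0 < u 2 ∧ u 2 * (1 - u 0 - u 1) < 1 ∧ u 2 * u 0 < 1 ∧
      u 2 * u 1 < 1) :
    0 < (1 - u 2 * (1 - u 0 - u 1)) * (1 - u 2 * u 0) * (1 - u 2 * u 1) ∧
      (1 - u 2 * (1 - u 0 - u 1)) * (1 - u 2 * u 0) * (1 - u 2 * u 1) < 1 := by
  obtain ⟨h0, h1, h01, hy, ha, hb, hc⟩ := hu
  have ha' : 0 < u 2 * (1 - u 0 - u 1) := mul_pos hy (by linarith)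
  have hb' : 0 < u 2 * u 0 := mul_pos hy h0
  have hc' : 0 < u 2 * u 1 := mul_pos hy h1
  refine ⟨by positivity, ?_⟩
  calc (1 - u 2 * (1 - u 0 - u 1)) * (1 - u 2 * u 0) * (1 - u 2 * u 1)
      < 1 * 1 * 1 := by gcongr <;> linarith
    _ = 1 := by ring

/-- Hence the geometric mean `ζ` lies in `(0,1)` on `U`. [folklore] -/
theorem zeta_mem {Z : (Fin 3 → ℝ) → ℝ}
    (hZ : ∀ u, Z u = ((1 - u 2 * (1 - u 0 - u 1)) * (1 - u 2 * u 0) * (1 - u 2 * u 1)) ^ ((1:ℝ)/3))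
    {u : Fin 3 → ℝ}
    (hu : 0 < u 0 ∧ 0 < u 1 ∧ u 0 + u 1 < 1 ∧ 0 < u 2 ∧ u 2 * (1 - u 0 - u 1) < 1 ∧ u 2 * u 0 < 1 ∧
      u 2 * u 1 < 1) :
    0 < Z u ∧ Z u < 1 := by
  obtain ⟨hp, hl⟩ := tprod_mem hu
  rw [hZ]
  exact ⟨rpow_pos_of_pos hp _, rpow_lt_one hp.le hl (by norm_num)⟩

/-- The chart domain `U` is `ℚ`-semialgebraic (finite intersection of polynomial strict
inequalities). [folklore] -/
theorem isSemialgebraic_U :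
    IsSemialgebraic ℚ {u : Fin 3 → ℝ | 0 < u 0 ∧ 0 < u 1 ∧ u 0 + u 1 < 1 ∧ 0 < u 2 ∧
      u 2 * (1 - u 0 - u 1) < 1 ∧ u 2 * u 0 < 1 ∧ u 2 * u 1 < 1} := by
  have h0 := isSemialgebraic_setOf_eval_pos (k := ℚ) (R := ℝ) (X 0 : MvPolynomial (Fin 3) ℚ)
  have h1 := isSemialgebraic_setOf_eval_pos (k := ℚ) (R := ℝ) (X 1 : MvPolynomial (Fin 3) ℚ)
  have h2 := isSemialgebraic_setOf_eval_lt (k := ℚ) (R := ℝ) (X 0 + X 1 : MvPolynomial (Fin 3) ℚ) 1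
  have h3 := isSemialgebraic_setOf_eval_pos (k := ℚ) (R := ℝ) (X 2 : MvPolynomial (Fin 3) ℚ)
  have h4 := isSemialgebraic_setOf_eval_lt (k := ℚ) (R := ℝ)
    (X 2 * (1 - X 0 - X 1) : MvPolynomial (Fin 3) ℚ) 1
  have h5 := isSemialgebraic_setOf_eval_lt (k := ℚ) (R := ℝ) (X 2 * X 0 : MvPolynomial (Fin 3) ℚ) 1
  have h6 := isSemialgebraic_setOf_eval_lt (k := ℚ) (R := ℝ) (X 2 * X 1 : MvPolynomial (Fin 3) ℚ) 1
  convert ((((((h0.inter h1).inter h2).inter h3).inter h4).inter h5).inter h6) using 1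
  ext u
  simp only [map_add, map_sub, map_mul, map_one, MvPolynomial.aeval_X, mem_setOf_eq, mem_inter_iff]
  tauto

/-- The chart domain is contained in the bounded box `(0,1) × (0,1) × (0,3)`. [folklore] -/
theorem U_subset_box {u : Fin 3 → ℝ}
    (hu : 0 < u 0 ∧ 0 < u 1 ∧ u 0 + u 1 < 1 ∧ 0 < u 2 ∧ u 2 * (1 - u 0 - u 1) < 1 ∧ u 2 * u 0 < 1 ∧
      u 2 * u 1 < 1) :
    u ∈ Set.Icc (0 : Fin 3 → ℝ) (fun i => if i = 2 then 3 else 1) := by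
  obtain ⟨h0, h1, h01, hy, ha, hb, hc⟩ := hu
  have hy3 : u 2 ≤ 3 := by
    by_contra h
    push Not at h
    -- one of the three angles is at least 1/3
    rcases le_or_gt (1/3 : ℝ) (u 0) with hu0 | hu0
    · nlinarith
    rcases le_or_gt (1/3 : ℝ) (u 1) with hu1 | hu1
    · nlinarith
    · nlinarith
  refine ⟨fun i => ?_, fun i => ?_⟩
  · fin_cases i <;> simp <;> linarith
  · fin_cases i <;> simp <;> linarith


/-- The band `U × [0,1]` of the `v`-move is `ℚ`-semialgebraic. [folklore] -/
theorem isSemialgebraic_bandV :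
    IsSemialgebraic ℚ (KZlog.band {u : Fin 3 → ℝ | 0 < u 0 ∧ 0 < u 1 ∧ u 0 + u 1 < 1 ∧ 0 < u 2 ∧
      u 2 * (1 - u 0 - u 1) < 1 ∧ u 2 * u 0 < 1 ∧ u 2 * u 1 < 1} (fun _ => 0) (fun _ => 1)) :=
  KZlog.isSemialgebraic_band (isSemialgebraicFunOn_const_of_isAlgebraic isSemialgebraic_U isAlgebraic_zero)
    (isSemialgebraicFunOn_const_of_isAlgebraic isSemialgebraic_U isAlgebraic_one)

/-- The band has finite volume (it lies in a bounded box). [folklore] -/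
theorem volume_bandV_lt_top :
    volume (KZlog.band {u : Fin 3 → ℝ | 0 < u 0 ∧ 0 < u 1 ∧ u 0 + u 1 < 1 ∧ 0 < u 2 ∧
      u 2 * (1 - u 0 - u 1) < 1 ∧ u 2 * u 0 < 1 ∧ u 2 * u 1 < 1} (fun _ => 0) (fun _ => 1)) < ⊤ := by
  refine lt_of_le_of_lt (measure_mono (fun w hw => ?_))
    (measure_Icc_lt_top (a := (0 : Fin 4 → ℝ)) (b := fun i => if i = 2 then 3 else 1))
  obtain ⟨hu, h0, h1⟩ := hw
  have hb := U_subset_box hu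
  refine ⟨fun i => ?_, fun i => ?_⟩
  · refine Fin.lastCases ?_ (fun j => ?_) i
    · simpa using h0
    · exact hb.1 j
  · refine Fin.lastCases ?_ (fun j => ?_) i
    · simpa using h1
    · have := hb.2 j
      revert this
      fin_cases j <;> simp [Fin.init]

/-- `ζ ∘ init` (the geometric mean of the box coordinates, read on the band) is `ℚ`-semialgebraic on
any `ℚ`-semialgebraic set on which the box coordinates are positive. [folklore] -/
theorem isSemialgebraicFunOn_zeta_init {S : Set (Fin 4 → ℝ)} (hS : IsSemialgebraic ℚ S)
    (hpos : ∀ w ∈ S, 0 < (1 - w 2 * (1 - w 0 - w 1)) * (1 - w 2 * w 0) * (1 - w 2 * w 1))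
    {Z : (Fin 3 → ℝ) → ℝ}
    (hZ : ∀ u, Z u = ((1 - u 2 * (1 - u 0 - u 1)) * (1 - u 2 * u 0) * (1 - u 2 * u 1)) ^ ((1:ℝ)/3)) :
    IsSemialgebraicFunOn ℚ S (fun w => Z (Fin.init w)) := by
  have hP := isSemialgebraicFunOn_aeval hS
    ((1 - X 2 * (1 - X 0 - X 1)) * (1 - X 2 * X 0) * (1 - X 2 * X 1) : MvPolynomial (Fin 4) ℚ)
  have hP' : IsSemialgebraicFunOn ℚ S
      (fun w : Fin 4 → ℝ => (1 - w 2 * (1 - w 0 - w 1)) * (1 - w 2 * w 0) * (1 - w 2 * w 1)) :=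
    hP.congr fun w _ => by simp
  refine (hP'.rpow_ratCast hS hpos (1/3)).congr fun w _ => ?_
  rw [hZ]
  simp only [Fin.init]
  push_cast
  rfl

end CornerV

/-- **The `v`-direction Newton–Leibniz move of the corner Stokes** (registered sub-goal `cornerStokesV`
of `stub_gmThreeShifted`). For `x, s ≥ 1`, a function `GD` bounded on the chart domain `U` by
`C(1−ζ)^(3s−1)` (`ζ = Z u` the geometric mean of the box coordinates) and a representation `rU` pinned as
`[U, GD]`, the band representation `[U × (0,1), ∂_v(v^(3x)((1−vζ)/(1−ζ))^(3s−1)·GD)]` exists and is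
equivalent to `rU`: ONE rule-3 move with the primitive `v^(3x)((1−vζ)/(1−ζ))^(3s−1)GD(u)` (vanishing at
`v = 0`, equal to `GD` at `v = 1`), then opening the fibres. [cite: KontsevichZagier2001, §1.2 rule (3)] -/
theorem cornerStokesV : ∀ (x s : ℚ), 1 ≤ x → 1 ≤ s → ∀ (Z GD : (Fin 3 → ℝ) → ℝ) (C : ℝ),
    (∀ u, Z u = ((1 - u 2 * (1 - u 0 - u 1)) * (1 - u 2 * u 0) * (1 - u 2 * u 1)) ^ ((1:ℝ)/3)) →
    (∀ u, (0 < u 0 ∧ 0 < u 1 ∧ u 0 + u 1 < 1 ∧ 0 < u 2 ∧ u 2 * (1 - u 0 - u 1) < 1 ∧ u 2 * u 0 < 1 ∧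
      u 2 * u 1 < 1) → |GD u| ≤ C * (1 - Z u) ^ (3 * (s:ℝ) - 1)) →
    ∀ (rU : KZ.IntegralRep 3),
    rU.domain = {u | 0 < u 0 ∧ 0 < u 1 ∧ u 0 + u 1 < 1 ∧ 0 < u 2 ∧ u 2 * (1 - u 0 - u 1) < 1 ∧
      u 2 * u 0 < 1 ∧ u 2 * u 1 < 1} →
    Set.EqOn rU.integrand GD rU.domain →
    ∃ N : KZ.IntegralRep 4,
      N.domain = {w | (Fin.init w : Fin 3 → ℝ) ∈ {u : Fin 3 → ℝ | 0 < u 0 ∧ 0 < u 1 ∧ u 0 + u 1 < 1 ∧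
        0 < u 2 ∧ u 2 * (1 - u 0 - u 1) < 1 ∧ u 2 * u 0 < 1 ∧ u 2 * u 1 < 1} ∧ 0 < w 3 ∧ w 3 < 1} ∧
      (N.integrand = fun w => (3 * (x:ℝ) * (w 3) ^ (3 * (x:ℝ) - 1) *
          ((1 - w 3 * Z (Fin.init w)) / (1 - Z (Fin.init w))) ^ (3 * (s:ℝ) - 1) -
        (3 * (s:ℝ) - 1) * (w 3) ^ (3 * (x:ℝ)) * Z (Fin.init w) *
          ((1 - w 3 * Z (Fin.init w)) / (1 - Z (Fin.init w))) ^ (3 * (s:ℝ) - 2) / (1 - Z (Fin.init w))) *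
        GD (Fin.init w)) ∧
      KZ.Equivalent N rU := by
  intro x s hx hs Z GD C hZ hGD rU hrU hrUi
  -- the chart domain, the band, positivity facts
  set U : Set (Fin 3 → ℝ) := {u | 0 < u 0 ∧ 0 < u 1 ∧ u 0 + u 1 < 1 ∧ 0 < u 2 ∧
    u 2 * (1 - u 0 - u 1) < 1 ∧ u 2 * u 0 < 1 ∧ u 2 * u 1 < 1} with hUdef
  have hUsa : IsSemialgebraic ℚ U := CornerV.isSemialgebraic_U
  have hZU : ∀ u ∈ U, 0 < Z u ∧ Z u < 1 := fun u hu => CornerV.zeta_mem hZ hu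
  have h3 : ((3 : Fin 4)) = Fin.last 3 := rfl
  set B : Set (Fin 4 → ℝ) := KZlog.band U (fun _ => 0) (fun _ => 1) with hBdef
  have hBsa : IsSemialgebraic ℚ B := CornerV.isSemialgebraic_bandV
  have hBmeas : MeasurableSet B :=
    Literature.ModelTheory.ExponentialFields.IsSemialgebraic.measurableSet_holds hBsa
  have hmemB : ∀ {w : Fin 4 → ℝ}, w ∈ B → (Fin.init w : Fin 3 → ℝ) ∈ U ∧ 0 ≤ w 3 ∧ w 3 ≤ 1 :=
    fun hw => hw
  -- the primitive `F` and its `v`-derivative `f`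
  set F : (Fin 4 → ℝ) → ℝ := fun w => (w 3) ^ (3 * (x:ℝ)) *
    ((1 - w 3 * Z (Fin.init w)) / (1 - Z (Fin.init w))) ^ (3 * (s:ℝ) - 1) * GD (Fin.init w) with hFdef
  set f : (Fin 4 → ℝ) → ℝ := fun w => (3 * (x:ℝ) * (w 3) ^ (3 * (x:ℝ) - 1) *
      ((1 - w 3 * Z (Fin.init w)) / (1 - Z (Fin.init w))) ^ (3 * (s:ℝ) - 1) -
    (3 * (s:ℝ) - 1) * (w 3) ^ (3 * (x:ℝ)) * Z (Fin.init w) *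
      ((1 - w 3 * Z (Fin.init w)) / (1 - Z (Fin.init w))) ^ (3 * (s:ℝ) - 2) / (1 - Z (Fin.init w))) *
    GD (Fin.init w) with hfdef
  -- positivity on the band
  have hρpos : ∀ {w : Fin 4 → ℝ}, w ∈ B →
      0 < 1 - Z (Fin.init w) ∧ 0 < (1 - w 3 * Z (Fin.init w)) / (1 - Z (Fin.init w)) := by
    intro w hw
    obtain ⟨hu, h0, h1⟩ := hmemB hw
    obtain ⟨hz0, hz1⟩ := hZU _ hu
    have hnum : 0 < 1 - w 3 * Z (Fin.init w) := by nlinarith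
    exact ⟨by linarith, div_pos hnum (by linarith)⟩
  -- semialgebraicity of the pieces on the band
  have hv : IsSemialgebraicFunOn ℚ B (fun w : Fin 4 → ℝ => w 3) := isSemialgebraicFunOn_apply hBsa 3
  have hZB : IsSemialgebraicFunOn ℚ B (fun w => Z (Fin.init w)) :=
    CornerV.isSemialgebraicFunOn_zeta_init hBsa (fun w hw => (CornerV.tprod_mem (hmemB hw).1).1) hZ
  have h1B : IsSemialgebraicFunOn ℚ B (fun _ : Fin 4 → ℝ => (1:ℝ)) :=
    isSemialgebraicFunOn_const_of_isAlgebraic hBsa isAlgebraic_one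
  have hρB : IsSemialgebraicFunOn ℚ B
      (fun w => (1 - w 3 * Z (Fin.init w)) / (1 - Z (Fin.init w))) :=
    (h1B.fun_sub (hv.fun_mul hZB)).div (h1B.fun_sub hZB) fun w hw => (hρpos hw).1.ne'
  have hGU : IsSemialgebraicFunOn ℚ U GD := by
    have h := rU.isSemialgebraicFunOn_integrand
    rw [hrU] at h
    exact h.congr fun u hu => hrUi (by rw [hrU]; exact hu)
  have hinit : IsSemialgebraicMapOn ℚ B (fun w : Fin 4 → ℝ => (Fin.init w : Fin 3 → ℝ)) :=
    IsSemialgebraicMapOn.of_forall hBsa fun j => (isSemialgebraicFunOn_apply hBsa (Fin.castSucc j)).congr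
      fun w _ => rfl
  have hGDB : IsSemialgebraicFunOn ℚ B (fun w => GD (Fin.init w)) :=
    (IsSemialgebraicFunOn.comp_isSemialgebraicMapOn_holds hGU hinit fun w hw => (hmemB hw).1).congr
      fun w _ => rfl
  have hx0 : (3 * x : ℚ) ≠ 0 := by positivity
  have hvpow : IsSemialgebraicFunOn ℚ B (fun w : Fin 4 → ℝ => (w 3) ^ (3 * (x:ℝ))) :=
    (hv.rpow_ratCast_of_nonneg (fun w hw => (hmemB hw).2.1) hx0).congr fun w _ => by
      push_cast; ring_nf
  have hvpow' : IsSemialgebraicFunOn ℚ B (fun w : Fin 4 → ℝ => (w 3) ^ (3 * (x:ℝ) - 1)) := by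
    have hx1 : (3 * x - 1 : ℚ) ≠ 0 := by
      have : (2:ℚ) ≤ 3 * x - 1 := by linarith
      linarith
    exact (hv.rpow_ratCast_of_nonneg (fun w hw => (hmemB hw).2.1) hx1).congr fun w _ => by
      push_cast; ring_nf
  have hρpow : IsSemialgebraicFunOn ℚ B
      (fun w => ((1 - w 3 * Z (Fin.init w)) / (1 - Z (Fin.init w))) ^ (3 * (s:ℝ) - 1)) :=
    (hρB.rpow_ratCast hBsa (fun w hw => (hρpos hw).2) (3 * s - 1)).congr fun w _ => by
      push_cast; ring_nf
  have hρpow' : IsSemialgebraicFunOn ℚ B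
      (fun w => ((1 - w 3 * Z (Fin.init w)) / (1 - Z (Fin.init w))) ^ (3 * (s:ℝ) - 2)) :=
    (hρB.rpow_ratCast hBsa (fun w hw => (hρpos hw).2) (3 * s - 2)).congr fun w _ => by
      push_cast; ring_nf
  have hcx : IsSemialgebraicFunOn ℚ B (fun _ : Fin 4 → ℝ => (3 * (x:ℝ))) :=
    (isSemialgebraicFunOn_ratCast hBsa (3 * x)).congr fun w _ => by push_cast; ring
  have hcs : IsSemialgebraicFunOn ℚ B (fun _ : Fin 4 → ℝ => (3 * (s:ℝ) - 1)) :=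
    (isSemialgebraicFunOn_ratCast hBsa (3 * s - 1)).congr fun w _ => by push_cast; ring
  have hFsa : IsSemialgebraicFunOn ℚ B F := (hvpow.fun_mul hρpow).fun_mul hGDB
  have hfsa : IsSemialgebraicFunOn ℚ B f :=
    ((((hcx.fun_mul hvpow').fun_mul hρpow).fun_sub
      ((((hcs.fun_mul hvpow).fun_mul hZB).fun_mul hρpow').div (h1B.fun_sub hZB)
        fun w hw => (hρpos hw).1.ne'))).fun_mul hGDB
  -- evaluation of `F` on a fibre
  have hFsnoc : ∀ (u : Fin 3 → ℝ) (t : ℝ), F (Fin.snoc u t) =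
      t ^ (3 * (x:ℝ)) * ((1 - t * Z u) / (1 - Z u)) ^ (3 * (s:ℝ) - 1) * GD u := by
    intro u t
    simp only [hFdef, h3, Fin.snoc_last, Fin.init_snoc]
  have hfsnoc : ∀ (u : Fin 3 → ℝ) (t : ℝ), f (Fin.snoc u t) =
      (3 * (x:ℝ) * t ^ (3 * (x:ℝ) - 1) * ((1 - t * Z u) / (1 - Z u)) ^ (3 * (s:ℝ) - 1) -
        (3 * (s:ℝ) - 1) * t ^ (3 * (x:ℝ)) * Z u * ((1 - t * Z u) / (1 - Z u)) ^ (3 * (s:ℝ) - 2) /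
          (1 - Z u)) * GD u := by
    intro u t
    simp only [hfdef, h3, Fin.snoc_last, Fin.init_snoc]
  have hx1R : (1:ℝ) ≤ x := by exact_mod_cast hx
  have hs1R : (1:ℝ) ≤ s := by exact_mod_cast hs
  have hxR : (0:ℝ) < 3 * (x:ℝ) := by linarith
  have hsR : (0:ℝ) ≤ 3 * (s:ℝ) - 2 := by linarith
  -- continuity of the primitive on the closed fibres
  have hcont : ∀ u ∈ U, ContinuousOn (fun t : ℝ => F (Fin.snoc u t)) (Icc (0:ℝ) 1) := by
    intro u hu
    obtain ⟨hz0, hz1⟩ := hZU u hu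
    have hc : Continuous fun t : ℝ => t ^ (3 * (x:ℝ)) * ((1 - t * Z u) / (1 - Z u)) ^ (3 * (s:ℝ) - 1) *
        GD u := by
      refine ((Real.continuous_rpow_const hxR.le).mul ?_).mul continuous_const
      exact ((continuous_const.sub (continuous_id.mul continuous_const)).div_const _).rpow_const
        fun t => Or.inr (by linarith)
    refine hc.continuousOn.congr fun t _ => ?_
    exact hFsnoc u t
  -- the fibrewise derivative
  have hder : ∀ u ∈ U, ∀ t ∈ Ioo ((fun _ : Fin 3 → ℝ => (0:ℝ)) u) ((fun _ : Fin 3 → ℝ => (1:ℝ)) u),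
      HasDerivAt (fun t : ℝ => F (Fin.snoc u t)) (f (Fin.snoc u t)) t := by
    intro u hu t ht
    obtain ⟨hz0, hz1⟩ := hZU u hu
    obtain ⟨ht0, ht1⟩ := ht
    have hρt : 0 < (1 - t * Z u) / (1 - Z u) := div_pos (by nlinarith) (by linarith)
    have h1 : HasDerivAt (fun t : ℝ => t ^ (3 * (x:ℝ))) (3 * (x:ℝ) * t ^ (3 * (x:ℝ) - 1)) t := by
      simpa using (hasDerivAt_id t).rpow_const (p := 3 * (x:ℝ)) (Or.inl ht0.ne')
    have h2 : HasDerivAt (fun t : ℝ => ((1 - t * Z u) / (1 - Z u)) ^ (3 * (s:ℝ) - 1))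
        (-(1 * Z u) / (1 - Z u) * (3 * (s:ℝ) - 1) *
          ((1 - t * Z u) / (1 - Z u)) ^ (3 * (s:ℝ) - 1 - 1)) t :=
      ((((hasDerivAt_id t).mul_const (Z u)).const_sub 1).div_const (1 - Z u)).rpow_const
        (Or.inl hρt.ne')
    rw [show (3:ℝ) * s - 1 - 1 = 3 * s - 2 by ring] at h2
    have h := (h1.mul h2).mul_const (GD u)
    simp only [hFsnoc, hfsnoc]
    refine h.congr_deriv ?_
    field_simp
    ring
  -- a uniform bound for the derivative on the band
  have hbound : ∀ w ∈ B, |f w| ≤ (3 * (x:ℝ) + (3 * (s:ℝ) - 1)) * C := by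
    intro w hw
    obtain ⟨hu, hv0, hv1⟩ := hmemB hw
    obtain ⟨hz0, hz1⟩ := hZU _ hu
    set v := w 3
    set z := Z (Fin.init w)
    set g := GD (Fin.init w)
    have h1z : 0 < 1 - z := by linarith
    have hz0' : 0 ≤ z := hz0.le
    have hz1' : z ≤ 1 := hz1.le
    have hvz0 : 0 ≤ 1 - v * z := by nlinarith
    have hvz1 : 1 - v * z ≤ 1 := by nlinarith
    have hρ0 : 0 ≤ (1 - v * z) / (1 - z) := div_nonneg hvz0 h1z.le
    have hρeq : (1 - v * z) / (1 - z) * (1 - z) = 1 - v * z := div_mul_cancel₀ _ h1z.ne'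
    set A := v ^ (3 * (x:ℝ) - 1) * ((1 - v * z) / (1 - z)) ^ (3 * (s:ℝ) - 1)
    set Bq := v ^ (3 * (x:ℝ)) * z * ((1 - v * z) / (1 - z)) ^ (3 * (s:ℝ) - 2) / (1 - z)
    have hA0 : 0 ≤ A := mul_nonneg (Real.rpow_nonneg hv0 _) (Real.rpow_nonneg hρ0 _)
    have hB0 : 0 ≤ Bq :=
      div_nonneg (mul_nonneg (mul_nonneg (Real.rpow_nonneg hv0 _) hz0') (Real.rpow_nonneg hρ0 _)) h1z.le
    -- the two elementary estimates `A (1−z)^(3s−1) ≤ 1`, `Bq (1−z)^(3s−1) ≤ 1`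
    have e1 : A * (1 - z) ^ (3 * (s:ℝ) - 1) ≤ 1 := by
      rw [mul_assoc, ← Real.mul_rpow hρ0 h1z.le, hρeq]
      have a1 : v ^ (3 * (x:ℝ) - 1) ≤ 1 := Real.rpow_le_one hv0 hv1 (by linarith)
      have a2 : (1 - v * z) ^ (3 * (s:ℝ) - 1) ≤ 1 := Real.rpow_le_one hvz0 hvz1 (by linarith)
      have a3 : 0 ≤ v ^ (3 * (x:ℝ) - 1) := Real.rpow_nonneg hv0 _
      nlinarith [Real.rpow_nonneg hvz0 (3 * (s:ℝ) - 1)]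
    have e2 : Bq * (1 - z) ^ (3 * (s:ℝ) - 1) ≤ 1 := by
      have hsplit : (1 - z) ^ (3 * (s:ℝ) - 1) = (1 - z) ^ (3 * (s:ℝ) - 2) * (1 - z) := by
        rw [← Real.rpow_add_one h1z.ne']; ring_nf
      have hBT : Bq * (1 - z) ^ (3 * (s:ℝ) - 1) =
          v ^ (3 * (x:ℝ)) * z * (((1 - v * z) / (1 - z)) * (1 - z)) ^ (3 * (s:ℝ) - 2) := by
        simp only [Bq]; rw [Real.mul_rpow hρ0 h1z.le, hsplit]; field_simp
      rw [hBT, hρeq]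
      have a1 : v ^ (3 * (x:ℝ)) ≤ 1 := Real.rpow_le_one hv0 hv1 hxR.le
      have a2 : (1 - v * z) ^ (3 * (s:ℝ) - 2) ≤ 1 := Real.rpow_le_one hvz0 hvz1 hsR
      have a3 : 0 ≤ v ^ (3 * (x:ℝ)) := Real.rpow_nonneg hv0 _
      have a4 : 0 ≤ (1 - v * z) ^ (3 * (s:ℝ) - 2) := Real.rpow_nonneg hvz0 _
      calc v ^ (3 * (x:ℝ)) * z * (1 - v * z) ^ (3 * (s:ℝ) - 2) ≤ 1 * 1 * 1 := by gcongr
        _ = 1 := by ring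
    have hg : |g| ≤ C * (1 - z) ^ (3 * (s:ℝ) - 1) := hGD _ hu
    have hpz : 0 < (1 - z) ^ (3 * (s:ℝ) - 1) := Real.rpow_pos_of_pos h1z _
    have hC : 0 ≤ C := by
      by_contra hneg
      have := mul_neg_of_neg_of_pos (not_le.mp hneg) hpz
      linarith [(abs_nonneg _).trans hg]
    have hs1 : 0 ≤ 3 * (s:ℝ) - 1 := by linarith
    have hfw : f w = (3 * (x:ℝ) * A - (3 * (s:ℝ) - 1) * Bq) * g := by
      simp only [hfdef, A, Bq]; ring
    rw [hfw, abs_mul]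
    calc |3 * (x:ℝ) * A - (3 * (s:ℝ) - 1) * Bq| * |g|
        ≤ (3 * (x:ℝ) * A + (3 * (s:ℝ) - 1) * Bq) * (C * (1 - z) ^ (3 * (s:ℝ) - 1)) := by
          refine mul_le_mul ((abs_sub _ _).trans ?_) hg (abs_nonneg _) (by positivity)
          rw [abs_of_nonneg (by positivity), abs_of_nonneg (by positivity)]
      _ = 3 * (x:ℝ) * C * (A * (1 - z) ^ (3 * (s:ℝ) - 1)) +
          (3 * (s:ℝ) - 1) * C * (Bq * (1 - z) ^ (3 * (s:ℝ) - 1)) := by ring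
      _ ≤ 3 * (x:ℝ) * C * 1 + (3 * (s:ℝ) - 1) * C * 1 := by gcongr
      _ = (3 * (x:ℝ) + (3 * (s:ℝ) - 1)) * C := by ring
  have hint : IntegrableOn f B :=
    ⟨aestronglyMeasurable_of_isSemialgebraicFunOn hfsa hBmeas,
      HasFiniteIntegral.restrict_of_bounded (C := (3 * (x:ℝ) + (3 * (s:ℝ) - 1)) * C)
        CornerV.volume_bandV_lt_top ((ae_restrict_mem hBmeas).mono fun w hw => by
          rw [Real.norm_eq_abs]; exact hbound w hw)⟩
  -- the boundary function is `GD` itself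
  have hbdry : ∀ u ∈ U, F (Fin.snoc u 1) - F (Fin.snoc u 0) = GD u := by
    intro u hu
    obtain ⟨hz0, hz1⟩ := hZU u hu
    rw [hFsnoc, hFsnoc, Real.one_rpow, Real.zero_rpow hxR.ne', one_mul,
      show (1 - 1 * Z u) / (1 - Z u) = 1 from by rw [one_mul]; exact div_self (by linarith),
      Real.one_rpow]
    ring
  have hds : IsSemialgebraicFunOn ℚ U (fun u => F (Fin.snoc u 1) - F (Fin.snoc u 0)) :=
    hGU.congr fun u hu => (hbdry u hu).symm
  have hUmeas : MeasurableSet U :=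
    Literature.ModelTheory.ExponentialFields.IsSemialgebraic.measurableSet_holds hUsa
  have hdi : IntegrableOn (fun u => F (Fin.snoc u 1) - F (Fin.snoc u 0)) U := by
    have h := rU.integrableOn
    rw [hrU] at h
    refine h.congr_fun (fun u hu => ?_) hUmeas
    rw [hrUi (by rw [hrU]; exact hu)]
    exact (hbdry u hu).symm
  have ha : IsSemialgebraicFunOn ℚ U (fun _ : Fin 3 → ℝ => (0:ℝ)) := by
    simpa using isSemialgebraicFunOn_ratCast hUsa 0
  have hb : IsSemialgebraicFunOn ℚ U (fun _ : Fin 3 → ℝ => (1:ℝ)) := by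
    simpa using isSemialgebraicFunOn_ratCast hUsa 1
  obtain ⟨rb, rd, hrbd, hrbi, hrdd, hrdi, hrel⟩ :=
    KZ.exists_band_newtonLeibniz hUsa (fun _ => 0) (fun _ => 1) ha hb (fun _ _ => zero_le_one)
      F f hFsa hfsa hcont hder hint hds hdi
  -- open the fibres
  obtain ⟨N, hNd, hNi, hNrel⟩ := KZ.of_sub_of_restrict_openBand_mem_relations ha hb rb hrbd
  refine ⟨N, ?_, ?_, ?_⟩
  · rw [hNd]
    ext w
    simp only [mem_setOf_eq, ← h3]
  · rw [hNi, hrbi]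
  · -- `N ∼ rb ∼ rd = [U, GD] ∼ rU`
    have hdU : KZ.of rd - KZ.of rU ∈ KZ.relations := by
      refine KZ.of_sub_of_mem_relations_of_eqOn (by rw [hrU, hrdd]) ?_
      intro u hu
      rw [hrdd] at hu
      rw [hrdi, hrUi (by rw [hrU]; exact hu)]
      exact hbdry u hu
    show KZ.of N - KZ.of rU ∈ KZ.relations
    have : KZ.of N - KZ.of rU = -(KZ.of rb - KZ.of N) + (KZ.of rb - KZ.of rd) + (KZ.of rd - KZ.of rU) := by
      abel
    rw [this]
    exact KZ.relations.add_mem (KZ.relations.add_mem (KZ.relations.neg_mem hNrel) hrel) hdU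

end Summit.KontsevichZagierPeriods.TerasomaMultiplication.MultiplicationAccessible

end
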